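import Summits.Ventures.CertifiedArithmetic.LowPrec.ErrorFreeAdd

/-!
# 2Sum is an error-free transformation in every minifloat format — saturation included

HONEST FRAMING (venture CertifiedArithmetic / cell `pub-lowprec`): certified error envelopes and
provably optimal rounding/accumulation schemes for low-precision formats under stated cost models;
every table by two implementations; no hardware or vendor claims.

The branch-free 2Sum of Møller–Knuth [KnuthTAOCP2, §4.2.2 Thm B; BoldoMelquiond2017, Thm 5.7
(Algorithm 5.2)]: `s = fl(a + b)`, `a' = fl(s - b)`, `b' = fl(s - a')`, `δa = fl(a - a')`,
`δb = fl(b - b')`, `t = fl(δa + δb)`. THEOREM (`twoSum_exact`): for data `a, b` of ANY format `φ`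
of the venture and the saturating round-to-nearest-even `fl = roundNE φ`, `t = a + b - s` EXACTLY —
with no hypothesis whatsoever (no precision, range, or "no overflow" condition; under IEEE
overflow-to-∞ the algorithm is not unconditionally robust [BoldoGraillatMuller2017], under OCP-style
saturation it is). The proof is short given `ErrorFreeAdd.lean` and `Sterbenz.lean`: with
`e = a + b - s ∈ F` (`addErr_representable`),
* if `|a| ≤ |b|`: `s - b ∈ F` (`round_sub_representable`), so `a' = s - b`, `b' = b`, `δa = e`,
  `δb = 0`, `t = e`;
* if `|b| < |a|` and `|b| ≤ |a + b|` (hence `|b| ≤ |s|`): `s - b = a - e` with `|e| ≤ |b| ≤ |a|`, so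
  `δa = a - a' ∈ F` and `b' = s - a' ∈ F` exactly (both by `round_sub_representable`), and
  `b - b' = -(a - e - a') = -ρ` with `ρ ∈ F` the error of `a' = fl(a - e)` (`addErr_representable`):
  `δb = -ρ`, `δa = e + ρ`, `t = fl(e) = e`;
* if `|a + b| < |b| < |a|`: the operands nearly cancel, `a + b ∈ F` by Sterbenz, and every step is
  exact with `t = 0 = e`.
Kernel cross-checks of the same statement by exhaustive evaluation (FP4/FP6) are in
`TwoSumCertificates.lean`.
-/

namespace Literature.ComputerArithmetic.FloatingPoint

namespace MiniFloat

open Format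

variable {φ : Format}

/-- `|b|` is the value of a datum (`b` or its sign flip). [folklore] -/
theorem exists_toRat_eq_abs (b : MiniFloat φ) : ∃ y : MiniFloat φ, y.toRat = |b.toRat| := by
  rcases le_or_gt 0 b.toRat with h | h
  · exact ⟨b, (abs_of_nonneg h).symm⟩
  · exact ⟨b.flipSign, by rw [toRat_flipSign, abs_of_neg h]⟩

/-- If `|b| ≤ |x|` for a datum `b`, then `|b| ≤ |fl x|` (monotonicity of `fl` on magnitudes).
[folklore] -/
theorem abs_toRat_le_abs_roundNE (b : MiniFloat φ) {x : ℚ} (h : |b.toRat| ≤ |x|) :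
    |b.toRat| ≤ |(roundNE φ x).toRat| := by
  obtain ⟨y, hy⟩ := exists_toRat_eq_abs b
  have := toRat_roundNE_mono (φ := φ) h
  rwa [← hy, toRat_roundNE_toRat, hy, ← abs_toRat_roundNE] at this

/-- Near-cancelling operands: if `|a + b| < |b| ≤ |a|` then `a + b` is a value of the format
(Sterbenz: `a` and `-b` are within a factor of two). [cite: BoldoMelquiond2017, Thm 5.1] -/
theorem exists_toRat_eq_add_of_cancel (a b : MiniFloat φ) (hba : |b.toRat| ≤ |a.toRat|)
    (hlt : |a.toRat + b.toRat| < |b.toRat|) : ∃ y : MiniFloat φ, y.toRat = a.toRat + b.toRat := by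
  rcases lt_or_ge 0 a.toRat with ha0 | ha0
  · -- `a > 0`, hence `b < 0`
    have hb0 : b.toRat < 0 := by
      by_contra h
      have h : 0 ≤ b.toRat := not_lt.mp h
      rw [abs_of_nonneg h, abs_of_nonneg (by linarith)] at hlt
      linarith
    rw [abs_of_neg hb0] at hlt hba
    rw [abs_of_pos ha0] at hba
    obtain ⟨h1, h2⟩ := abs_lt.mp hlt
    obtain ⟨d, hd⟩ := sterbenz a b.flipSign (by rw [toRat_flipSign]; linarith)
      (by rw [toRat_flipSign]; linarith)
    exact ⟨d, by rw [hd, toRat_flipSign]; ring⟩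
  · -- `a ≤ 0`; as `|b| < |a|`... in fact `a < 0` and `b > 0`
    have ha0' : a.toRat < 0 := by
      rcases eq_or_lt_of_le ha0 with h | h
      · exfalso; rw [h, abs_zero] at hba; have := abs_nonneg (a.toRat + b.toRat); linarith
      · exact h
    have hb0 : 0 < b.toRat := by
      by_contra h
      have h : b.toRat ≤ 0 := not_lt.mp h
      rw [abs_of_nonpos h, abs_of_nonpos (by linarith)] at hlt
      linarith
    rw [abs_of_pos hb0] at hlt hba
    rw [abs_of_neg ha0'] at hba
    obtain ⟨h1, h2⟩ := abs_lt.mp hlt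
    obtain ⟨d, hd⟩ := sterbenz a.flipSign b (by rw [toRat_flipSign]; linarith)
      (by rw [toRat_flipSign]; linarith)
    exact ⟨d.flipSign, by rw [toRat_flipSign, hd, toRat_flipSign]; ring⟩

/-- 2SUM IS AN ERROR-FREE TRANSFORMATION IN EVERY MINIFLOAT FORMAT under saturating
round-to-nearest-even, unconditionally: for data `a, b`, with `s = fl(a + b)`, `a' = fl(s - b)`,
`b' = fl(s - a')`, `δa = fl(a - a')`, `δb = fl(b - b')`, the value `fl(δa + δb)` equals
`a + b - s` exactly. [cite: BoldoMelquiond2017, Thm 5.7 (no-overflow statement; the saturation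
cases are new)] -/
theorem twoSum_exact (a b : MiniFloat φ) :
    (roundNE φ ((roundNE φ (a.toRat - (roundNE φ ((roundNE φ (a.toRat + b.toRat)).toRat
        - b.toRat)).toRat)).toRat
      + (roundNE φ (b.toRat - (roundNE φ ((roundNE φ (a.toRat + b.toRat)).toRat
        - (roundNE φ ((roundNE φ (a.toRat + b.toRat)).toRat - b.toRat)).toRat)).toRat)).toRat)).toRat
      = a.toRat + b.toRat - (roundNE φ (a.toRat + b.toRat)).toRat := by
  set s := roundNE φ (a.toRat + b.toRat) with hs
  set a' := roundNE φ (s.toRat - b.toRat) with ha'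
  set b' := roundNE φ (s.toRat - a'.toRat) with hb'
  obtain ⟨e, he⟩ := addErr_representable a b
  rw [← hs] at he
  rcases le_or_gt |a.toRat| |b.toRat| with hab | hba
  · -- Case `|a| ≤ |b|`: Fast2Sum with the roles of `a` and `b` exchanged
    have h1 : a'.toRat = s.toRat - b.toRat := by
      obtain ⟨z, hz⟩ := round_sub_representable b a hab
      rw [add_comm b.toRat a.toRat, ← hs] at hz
      exact toRat_roundNE_of_exists ⟨z, hz⟩
    have h2 : b'.toRat = b.toRat := by
      rw [hb', h1, show s.toRat - (s.toRat - b.toRat) = b.toRat by ring, toRat_roundNE_toRat]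
    have h3 : (roundNE φ (a.toRat - a'.toRat)).toRat = e.toRat := by
      rw [h1, show a.toRat - (s.toRat - b.toRat) = e.toRat by rw [he]; ring, toRat_roundNE_toRat]
    have h4 : (roundNE φ (b.toRat - b'.toRat)).toRat = 0 := by
      rw [h2, sub_self, toRat_roundNE_zero]
    rw [h3, h4, add_zero, toRat_roundNE_toRat, he]
  · by_cases hsb : |b.toRat| ≤ |a.toRat + b.toRat|
    · -- Case `|b| < |a|`, `|b| ≤ |a + b|` (so `|b| ≤ |s|`)
      have hbs : |b.toRat| ≤ |s.toRat| := abs_toRat_le_abs_roundNE b hsb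
      -- `|e| ≤ |b| ≤ |a|` (the operand `a` is a rounding candidate)
      have he_le : |e.toRat| ≤ |a.toRat| := by
        have h := roundNE_nearest (φ := φ) (a.toRat + b.toRat) a
        rw [← hs, show a.toRat + b.toRat - a.toRat = b.toRat by ring] at h
        rw [he]; exact le_trans h hba.le
      -- `s - b = a + (-e)`
      have hse : s.toRat - b.toRat = a.toRat + e.flipSign.toRat := by
        rw [toRat_flipSign, he]; ring
      -- P1: `δa = a - a'` exactly
      have hP1 : ∃ z : MiniFloat φ, z.toRat = a.toRat - a'.toRat := by
        obtain ⟨z, hz⟩ := round_sub_representable a e.flipSign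
          (by rw [toRat_flipSign, abs_neg]; exact he_le)
        refine ⟨z.flipSign, ?_⟩
        rw [toRat_flipSign, hz, ha', hse]; ring
      have hδa : (roundNE φ (a.toRat - a'.toRat)).toRat = a.toRat - a'.toRat :=
        toRat_roundNE_of_exists hP1
      -- P2: `b' = s - a'` exactly
      have hP2 : ∃ z : MiniFloat φ, z.toRat = s.toRat - a'.toRat := by
        obtain ⟨z, hz⟩ := round_sub_representable s b.flipSign
          (by rw [toRat_flipSign, abs_neg]; exact hbs)
        refine ⟨z.flipSign, ?_⟩
        rw [toRat_flipSign, hz, ha', toRat_flipSign, ← sub_eq_add_neg]; ring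
      have hb'v : b'.toRat = s.toRat - a'.toRat := by rw [hb']; exact toRat_roundNE_of_exists hP2
      -- `ρ = (a - e) - a' ∈ F`, and `b - b' = -ρ`
      obtain ⟨ρ, hρ⟩ := addErr_representable a e.flipSign
      rw [← hse, ← ha'] at hρ
      have hδb : (roundNE φ (b.toRat - b'.toRat)).toRat = -ρ.toRat := by
        have : b.toRat - b'.toRat = ρ.flipSign.toRat := by
          rw [toRat_flipSign, hρ, hb'v]; ring
        rw [this, toRat_roundNE_toRat, toRat_flipSign]
      have hsum : a.toRat - a'.toRat + -ρ.toRat = e.toRat := by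
        rw [hρ, he]; ring
      rw [hδa, hδb, hsum, toRat_roundNE_toRat, he]
    · -- Case `|a + b| < |b| < |a|`: near-cancellation, everything is exact and `e = 0`
      have hsum := exists_toRat_eq_add_of_cancel a b hba.le (not_le.mp hsb)
      have hsv : s.toRat = a.toRat + b.toRat := by rw [hs]; exact toRat_roundNE_of_exists hsum
      have h1 : a'.toRat = a.toRat := by
        rw [ha', hsv, show a.toRat + b.toRat - b.toRat = a.toRat by ring, toRat_roundNE_toRat]
      have h2 : b'.toRat = b.toRat := by
        rw [hb', h1, hsv, show a.toRat + b.toRat - a.toRat = b.toRat by ring, toRat_roundNE_toRat]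
      rw [h1, h2, sub_self, sub_self, toRat_roundNE_zero, add_zero, toRat_roundNE_zero, hsv, sub_self]

/-- 2Sum and Fast2Sum agree whenever Fast2Sum applies: with `|b| ≤ |a|` both return `a + b - s`.
[folklore] -/
theorem twoSum_eq_fast2Sum (a b : MiniFloat φ) (hab : |b.toRat| ≤ |a.toRat|) :
    (roundNE φ ((roundNE φ (a.toRat - (roundNE φ ((roundNE φ (a.toRat + b.toRat)).toRat
        - b.toRat)).toRat)).toRat
      + (roundNE φ (b.toRat - (roundNE φ ((roundNE φ (a.toRat + b.toRat)).toRat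
        - (roundNE φ ((roundNE φ (a.toRat + b.toRat)).toRat - b.toRat)).toRat)).toRat)).toRat)).toRat
      = (roundNE φ (b.toRat - (roundNE φ ((roundNE φ (a.toRat + b.toRat)).toRat
          - a.toRat)).toRat)).toRat := by
  rw [twoSum_exact, (fast2Sum_exact a b hab).2]

end MiniFloat

end Literature.ComputerArithmetic.FloatingPoint
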